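import Mathlib
import HarnessLib
import Summits.HubbardSuperconductivity.HubbardSuperconductivity.Theorems.WeakCouplingBCSKlCertTPrimePocketRadiusContinuous
import Summits.HubbardSuperconductivity.HubbardSuperconductivity.Theorems.WeakCouplingBCSKlCertTPm03ChiHSOfGeometry

/-!
# Route `WeakCouplingBCS` — certificate half of stmt-HubbardSuperconductivity-0158, item «CONVEX-WINDOW-HS», file S1:
# the SHELL VOLUME estimate (SV) `vol(BZ ∩ {|ε_{t′} − μ| < t}) ≤ C_sh·t` on the WHOLE open Γ-window, by polar coordinates

Cell `gate-hubbard-kl`, seat p4 (g24); zero kit; no definitions.  For `|t′| < 1/2` and `−4 − 4t′ < μ < 4t′` the level `μ` avoids every critical level of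
`ε_{t′}` (band bottom `−4 − 4t′` at `Γ`, van Hove level `4t′`), so the thin shells around the Γ-pocket have volume `O(t)`.  Chart-free slicing did this at the
`(⅛, −3/10)` cell only (✓ `kltp_shellVolume_m03`, explicit numerics); here it is done GENERICALLY with the polar chart `u = kltpRadius` of margin-1's stack:

* §1 monotonicity of the radius in the level, the crude bound `u < 5`, continuity of `∂_tF_{t′}` in `(θ, r)`;
* §2 `kltp_exists_rayDt_floor` — a floor `v > 0` of the radial derivative `∂_tF_{t′}(θ, r)` on the compact annulus between the level curves `μ ± t₀`
  (continuity + positivity ✓ `kltpRayDt_pos_of_lt_exit` + compactness);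
* §3 `kltp_radius_increment_le` — `u(μ + t, θ) − u(μ − t, θ) ≤ 2t/v` (mean-value inequality `Convex.mul_sub_le_image_sub_of_le_deriv` for `r ↦ F_{t′}(θ, r)`);
* §4 `kltp_shellVolume_le_of_floor` — for `t ≤ t₀` the shell lies, in polar coordinates (`lintegral_comp_polarCoord_symm`, strict radial monotonicity
  ✓ `strictMonoOn_kltpRay`), inside `{(r, θ) : u(μ−t, θ) < r < u(μ+t, θ)}` with `r < 5`, whose area is `∫ (u(μ+t) − u(μ−t)) dθ ≤ 2π·2t/v`
  (`volume_regionBetween_eq_lintegral'`) ⇒ `vol ≤ (20π/v)·t`;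
* §5 **`kltp_exists_shellVolume_le (htp) (hμ₁) (hμ₂) : ∃ C ≥ 0, ∀ t > 0, vol(BZ ∩ {|ε_{t′} − μ| < t}) ≤ ofReal (C·t)`** (above `t₀`: `vol BZ ≤ 4π²`).

This is the (SV) input `hSV` of ✓ `klg_memLp_kernel_of_geometry` for EVERY Γ-window cell; the companion `…KlCertTPrimeConvexHS` assembles the generic HS row.
Honest framing: nothing here asserts an HS row, a margin, `K₃`, `U₀`, the window or superconductivity; a Kohn–Luttinger `O(U²)` channel statement is not ODLRO;
nothing here proves superconductivity in the Hubbard model.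
References: S. Raghu, S. A. Kivelson, D. J. Scalapino, Phys. Rev. B 81 (2010) 224505, §II (6); E. M. Stein, *Harmonic Analysis* (1993), Ch. VIII §1.
-/

noncomputable section

-- the tree's namespace `Summit.<Summit>.<Problem>.Theorems` repeats the summit name by design (D-0017)
set_option linter.dupNamespace false

namespace Summit.HubbardSuperconductivity.HubbardSuperconductivity.Theorems

open Real Set Filter MeasureTheory MeasureTheory.Measure Literature.MathematicalPhysics.QuantumLattice
open scoped Topology ENNReal

/-! ### §1 The radius as a function of the level; continuity of the radial derivative -/

/-- **The radius is strictly increasing in the level**: `u(μ₁, θ) < u(μ₂, θ)` for `μ₁ < μ₂` in the Γ-window (strict radial monotonicity of `F_{t′}`).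
[folklore] -/
theorem kltpRadius_lt_of_lt {tp μ₁ μ₂ : ℝ} (htp : |tp| < 1 / 2) (h₁ : -4 - 4 * tp < μ₁) (h₁₂ : μ₁ < μ₂) (h₂ : μ₂ < 4 * tp) (θ : ℝ) :
    kltpRadius tp μ₁ θ < kltpRadius tp μ₂ θ := by
  have hu₁ := isKltpRadius_kltpRadius htp h₁ (h₁₂.trans h₂) θ
  have hu₂ := isKltpRadius_kltpRadius htp (h₁.trans h₁₂) h₂ θ
  refine ((strictMonoOn_kltpRay htp θ).lt_iff_lt hu₁.mem_Icc hu₂.mem_Icc).1 ?_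
  rw [hu₁.2, hu₂.2]; exact h₁₂

/-- The radius is monotone in the level. [folklore] -/
theorem kltpRadius_le_of_le {tp μ₁ μ₂ : ℝ} (htp : |tp| < 1 / 2) (h₁ : -4 - 4 * tp < μ₁) (h₁₂ : μ₁ ≤ μ₂) (h₂ : μ₂ < 4 * tp) (θ : ℝ) :
    kltpRadius tp μ₁ θ ≤ kltpRadius tp μ₂ θ := by
  rcases h₁₂.eq_or_lt with h | h
  · rw [h]
  · exact (kltpRadius_lt_of_lt htp h₁ h h₂ θ).le

/-- A crude bound: `u(μ, θ) < 5` (the curve lies in the open square of side `2π`, and `2π² < 25`). [folklore] -/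
theorem kltpRadius_lt_five {tp μ : ℝ} (htp : |tp| < 1 / 2) (hμ₁ : -4 - 4 * tp < μ) (hμ₂ : μ < 4 * tp) (θ : ℝ) :
    kltpRadius tp μ θ < 5 := by
  have h0 := abs_kltpRadius_mul_dir_lt htp hμ₁ hμ₂ θ 0
  have h1 := abs_kltpRadius_mul_dir_lt htp hμ₁ hμ₂ θ 1
  simp only [dir_zero, dir_one] at h0 h1
  have hu := kltpRadius_pos htp hμ₁ hμ₂ θ
  have hπ := Real.pi_lt_d2  -- π < 3.15
  have hsc := Real.sin_sq_add_cos_sq θ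
  have hc := abs_lt.1 h0
  have hs := abs_lt.1 h1
  nlinarith [sq_nonneg (kltpRadius tp μ θ * Real.cos θ), sq_nonneg (kltpRadius tp μ θ * Real.sin θ),
    mul_pos hu hu, sq_abs (kltpRadius tp μ θ * Real.cos θ), sq_abs (kltpRadius tp μ θ * Real.sin θ),
    abs_nonneg (kltpRadius tp μ θ * Real.cos θ), abs_nonneg (kltpRadius tp μ θ * Real.sin θ)]

/-- `∂_tF_{t′}` is jointly continuous in `(θ, r)`. [folklore] -/
theorem continuous_kltpRayDt_uncurry (tp : ℝ) : Continuous fun q : ℝ × ℝ => kltpRayDt tp q.1 q.2 := by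
  unfold kltpRayDt; fun_prop

/-! ### §2 A floor for the radial derivative on the annulus between two level curves -/

/-- **A radial-derivative floor on the annulus `u(μ − t₀, θ) ≤ r ≤ u(μ + t₀, θ)`, `θ ∈ [−π, π]`** (the annulus is compact, `∂_tF_{t′}` is continuous and
positive there). [folklore] -/
theorem kltp_exists_rayDt_floor {tp μ t₀ : ℝ} (htp : |tp| < 1 / 2) (h₁ : -4 - 4 * tp < μ - t₀) (h₂ : μ + t₀ < 4 * tp) (ht₀ : 0 ≤ t₀) :
    ∃ v : ℝ, 0 < v ∧ ∀ θ ∈ Icc (-π) π, ∀ r : ℝ, kltpRadius tp (μ - t₀) θ ≤ r → r ≤ kltpRadius tp (μ + t₀) θ → v ≤ kltpRayDt tp θ r := by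
  have hL₂ : μ - t₀ < 4 * tp := by linarith
  have hU₁ : -4 - 4 * tp < μ + t₀ := by linarith
  have huL := continuous_kltpRadius htp h₁ hL₂
  have huU := continuous_kltpRadius htp hU₁ h₂
  set K : Set (ℝ × ℝ) := ({q : ℝ × ℝ | q.1 ∈ Icc (-π) π} ∩ {q | kltpRadius tp (μ - t₀) q.1 ≤ q.2}) ∩
    {q | q.2 ≤ kltpRadius tp (μ + t₀) q.1} with hK
  have hKclosed : IsClosed K :=
    ((isClosed_Icc.preimage continuous_fst).inter (isClosed_le (huL.comp continuous_fst) continuous_snd)).inter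
      (isClosed_le continuous_snd (huU.comp continuous_fst))
  have hKsub : K ⊆ Icc (-π) π ×ˢ Icc (0 : ℝ) 5 := by
    rintro ⟨θ, r⟩ ⟨⟨hθ, hr₁⟩, hr₂⟩
    refine ⟨hθ, ⟨?_, ?_⟩⟩
    · exact (kltpRadius_pos htp h₁ hL₂ θ).le.trans hr₁
    · exact hr₂.trans (kltpRadius_lt_five htp hU₁ h₂ θ).le
  have hKc : IsCompact K := (isCompact_Icc.prod isCompact_Icc).of_isClosed_subset hKclosed hKsub
  have hne : K.Nonempty := by
    refine ⟨(0, kltpRadius tp (μ - t₀) 0), ⟨⟨?_, ?_⟩, ?_⟩⟩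
    · show (0 : ℝ) ∈ Icc (-π) π
      exact ⟨by linarith [Real.pi_pos], by linarith [Real.pi_pos]⟩
    · show kltpRadius tp (μ - t₀) 0 ≤ kltpRadius tp (μ - t₀) 0
      exact le_rfl
    · show kltpRadius tp (μ - t₀) 0 ≤ kltpRadius tp (μ + t₀) 0
      exact kltpRadius_le_of_le htp h₁ (by linarith) h₂ 0
  obtain ⟨z, hzK, hzmin⟩ := hKc.exists_isMinOn hne (continuous_kltpRayDt_uncurry tp).continuousOn
  have hmin' : ∀ q : ℝ × ℝ, q ∈ K → kltpRayDt tp z.1 z.2 ≤ kltpRayDt tp q.1 q.2 := fun q hq => isMinOn_iff.1 hzmin q hq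
  refine ⟨kltpRayDt tp z.1 z.2, ?_, fun θ hθ r hr₁ hr₂ => hmin' (θ, r) ⟨⟨hθ, hr₁⟩, hr₂⟩⟩
  have hz₁ : kltpRadius tp (μ - t₀) z.1 ≤ z.2 := hzK.1.2
  have hz₂ : z.2 ≤ kltpRadius tp (μ + t₀) z.1 := hzK.2
  have hpos : 0 < z.2 := (kltpRadius_pos htp h₁ hL₂ z.1).trans_le hz₁
  have hlt : z.2 * ‖dir z.1‖ < π := by
    rw [← lt_div_iff₀ (norm_dir_pos z.1)]
    exact hz₂.trans_lt (kltpRadius_lt_exit htp hU₁ h₂ z.1)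
  exact kltpRayDt_pos_of_lt_exit htp hpos hlt

/-! ### §3 The radius increment across a thin shell -/

/-- **`u(μ + t, θ) − u(μ − t, θ) ≤ 2t/v`** for `0 < t ≤ t₀`, `θ ∈ [−π, π]`, given a radial-derivative floor `v` on the annulus between `μ ± t₀` (mean-value
inequality for `r ↦ F_{t′}(θ, r)`, whose values at the two radii differ by exactly `2t`). [folklore] -/
theorem kltp_radius_increment_le {tp μ t₀ t v : ℝ} (htp : |tp| < 1 / 2) (h₁ : -4 - 4 * tp < μ - t₀) (h₂ : μ + t₀ < 4 * tp)
    (ht : 0 < t) (htt : t ≤ t₀) (hv : 0 < v)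
    (hfloor : ∀ θ ∈ Icc (-π) π, ∀ r : ℝ, kltpRadius tp (μ - t₀) θ ≤ r → r ≤ kltpRadius tp (μ + t₀) θ → v ≤ kltpRayDt tp θ r)
    {θ : ℝ} (hθ : θ ∈ Icc (-π) π) :
    kltpRadius tp (μ + t) θ - kltpRadius tp (μ - t) θ ≤ 2 * t / v := by
  have hm₁ : -4 - 4 * tp < μ - t := by linarith
  have hm₂ : μ - t < 4 * tp := by linarith
  have hp₁ : -4 - 4 * tp < μ + t := by linarith
  have hp₂ : μ + t < 4 * tp := by linarith
  set a := kltpRadius tp (μ - t) θ with ha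
  set b := kltpRadius tp (μ + t) θ with hb
  have hab : a ≤ b := kltpRadius_le_of_le htp hm₁ (by linarith) hp₂ θ
  have haK : kltpRadius tp (μ - t₀) θ ≤ a := kltpRadius_le_of_le htp h₁ (by linarith) hm₂ θ
  have hbK : b ≤ kltpRadius tp (μ + t₀) θ := kltpRadius_le_of_le htp hp₁ (by linarith) h₂ θ
  have hmv := Convex.mul_sub_le_image_sub_of_le_deriv (convex_Icc a b) (continuous_kltpRay tp θ).continuousOn
    (fun x _ => (hasDerivAt_kltpRay tp θ x).differentiableAt.differentiableWithinAt) (C := v)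
    (fun x hx => by
      rw [interior_Icc] at hx
      rw [(hasDerivAt_kltpRay tp θ x).deriv]
      exact hfloor θ hθ x (haK.trans hx.1.le) (hx.2.le.trans hbK))
    a (left_mem_Icc.2 hab) b (right_mem_Icc.2 hab) hab
  rw [hb, ha, kltpRay_kltpRadius htp hp₁ hp₂, kltpRay_kltpRadius htp hm₁ hm₂] at hmv
  rw [le_div_iff₀ hv]
  linarith

/-! ### §4 The shell volume below the margin, in polar coordinates -/

/-- **(SV) below the margin**: for `0 < t ≤ t₀` (with `[μ − t₀, μ + t₀]` inside the Γ-window and a radial floor `v` on the annulus)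
`vol(BZ ∩ {|ε_{t′} − μ| < t}) ≤ (20π/v)·t`. [cite: SteinHarmonicAnalysis1993, Ch. VIII §1] -/
theorem kltp_shellVolume_le_of_floor {tp μ t₀ t v : ℝ} (htp : |tp| < 1 / 2) (h₁ : -4 - 4 * tp < μ - t₀) (h₂ : μ + t₀ < 4 * tp)
    (ht : 0 < t) (htt : t ≤ t₀) (hv : 0 < v)
    (hfloor : ∀ θ ∈ Icc (-π) π, ∀ r : ℝ, kltpRadius tp (μ - t₀) θ ≤ r → r ≤ kltpRadius tp (μ + t₀) θ → v ≤ kltpRayDt tp θ r) :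
    volume (brillouinZone ∩ {p : Momentum | |squareDispersion 1 tp p - μ| < t}) ≤ ENNReal.ofReal (20 * π / v * t) := by
  have hm₁ : -4 - 4 * tp < μ - t := by linarith
  have hm₂ : μ - t < 4 * tp := by linarith
  have hp₁ : -4 - 4 * tp < μ + t := by linarith
  have hp₂ : μ + t < 4 * tp := by linarith
  -- (1) to the coordinate plane
  set S' : Set (ℝ × ℝ) := {q : ℝ × ℝ | (q.1 ∈ Ico (-π) π ∧ q.2 ∈ Ico (-π) π) ∧
    |(-2 * 1 * (Real.cos q.1 + Real.cos q.2) - 4 * tp * Real.cos q.1 * Real.cos q.2) - μ| < t} with hS'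
  have hS'm : MeasurableSet S' := by
    have h1 : MeasurableSet {q : ℝ × ℝ | q.1 ∈ Ico (-π) π ∧ q.2 ∈ Ico (-π) π} :=
      (measurable_fst measurableSet_Ico).inter (measurable_snd measurableSet_Ico)
    have h2 : MeasurableSet {q : ℝ × ℝ |
        |(-2 * 1 * (Real.cos q.1 + Real.cos q.2) - 4 * tp * Real.cos q.1 * Real.cos q.2) - μ| < t} :=
      (isOpen_lt (by fun_prop) continuous_const).measurableSet
    exact h1.inter h2
  have hpre : brillouinZone ∩ {p : Momentum | |squareDispersion 1 tp p - μ| < t} =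
      (fun k : Momentum => ((k 0, k 1) : ℝ × ℝ)) ⁻¹' S' := by
    ext p; simp [hS', brillouinZone, squareDispersion, Fin.forall_fin_two]
  rw [hpre, measurePreserving_momentum_prod.measure_preimage hS'm.nullMeasurableSet]
  -- (2) polar coordinates
  have key := lintegral_comp_polarCoord_symm (S'.indicator (1 : ℝ × ℝ → ℝ≥0∞))
  rw [lintegral_indicator_one hS'm] at key
  rw [← key]
  -- the comparison region `{(r, θ) : θ ∈ (−π, π), u(μ−t, θ) < r < u(μ+t, θ)}`
  set uL : ℝ → ℝ := fun θ => kltpRadius tp (μ - t) θ with huL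
  set uU : ℝ → ℝ := fun θ => kltpRadius tp (μ + t) θ with huU
  have huLc : Continuous uL := continuous_kltpRadius htp hm₁ hm₂
  have huUc : Continuous uU := continuous_kltpRadius htp hp₁ hp₂
  set R : Set (ℝ × ℝ) := regionBetween uL uU (Ioo (-π) π) with hR
  have hRm : MeasurableSet R := measurableSet_regionBetween huLc.measurable huUc.measurable measurableSet_Ioo
  set A : Set (ℝ × ℝ) := Prod.swap ⁻¹' R with hA
  have hAm : MeasurableSet A := measurable_swap hRm
  -- (3) pointwise comparison on the polar target
  have hpt : ∀ p ∈ polarCoord.target,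
      ENNReal.ofReal p.1 • S'.indicator (1 : ℝ × ℝ → ℝ≥0∞) (polarCoord.symm p) ≤ ENNReal.ofReal 5 * A.indicator (1 : ℝ × ℝ → ℝ≥0∞) p := by
    rintro ⟨r, θ⟩ hp
    rw [polarCoord_target] at hp
    obtain ⟨hr, hθ⟩ := hp
    simp only [mem_Ioi] at hr
    by_cases hS : polarCoord.symm (r, θ) ∈ S'
    · -- the point `(r cos θ, r sin θ)` is in the shell: compare radii along the ray
      have hq : polarCoord.symm (r, θ) = (r * Real.cos θ, r * Real.sin θ) := rfl
      rw [hq] at hS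
      obtain ⟨⟨hx, hy⟩, hε⟩ := hS
      simp only at hx hy hε
      have hray : kltpRay tp θ r = -2 * 1 * (Real.cos (r * Real.cos θ) + Real.cos (r * Real.sin θ)) -
          4 * tp * Real.cos (r * Real.cos θ) * Real.cos (r * Real.sin θ) := by simp only [kltpRay]; ring
      have hεr : |kltpRay tp θ r - μ| < t := by rw [hray]; exact hε
      have hrdir : r * ‖dir θ‖ ≤ π := by
        have e1 : r * |Real.cos θ| = |r * Real.cos θ| := by rw [abs_mul, abs_of_pos hr]
        have e2 : r * |Real.sin θ| = |r * Real.sin θ| := by rw [abs_mul, abs_of_pos hr]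
        rw [norm_dir, mul_max_of_nonneg _ _ hr.le, e1, e2]
        exact max_le (abs_le.2 ⟨hx.1, hx.2.le⟩) (abs_le.2 ⟨hy.1, hy.2.le⟩)
      have hrI : r ∈ Icc 0 (π / ‖dir θ‖) := ⟨hr.le, by rw [le_div_iff₀ (norm_dir_pos θ)]; exact hrdir⟩
      have hLr := isKltpRadius_kltpRadius htp hm₁ hm₂ θ
      have hUr := isKltpRadius_kltpRadius htp hp₁ hp₂ θ
      have hmono := strictMonoOn_kltpRay htp θ
      have h_lo : uL θ < r := by
        refine (hmono.lt_iff_lt hLr.mem_Icc hrI).1 ?_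
        rw [hLr.2]; linarith [(abs_lt.1 hεr).1]
      have h_hi : r < uU θ := by
        refine (hmono.lt_iff_lt hrI hUr.mem_Icc).1 ?_
        rw [hUr.2]; linarith [(abs_lt.1 hεr).2]
      have hmemA : ((r, θ) : ℝ × ℝ) ∈ A := by
        simp only [hA, mem_preimage, Prod.swap_prod_mk, hR, regionBetween, mem_setOf_eq]
        exact ⟨hθ, h_lo, h_hi⟩
      have hr5 : r ≤ 5 := by
        have hπ := Real.pi_lt_d2
        have hr2 : (r * Real.cos θ) ^ 2 + (r * Real.sin θ) ^ 2 = r ^ 2 := by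
          calc (r * Real.cos θ) ^ 2 + (r * Real.sin θ) ^ 2 = r ^ 2 * (Real.cos θ ^ 2 + Real.sin θ ^ 2) := by ring
            _ = r ^ 2 := by rw [Real.cos_sq_add_sin_sq, mul_one]
        have hc2 : (r * Real.cos θ) ^ 2 ≤ π ^ 2 := by nlinarith [hx.1, hx.2]
        have hs2 : (r * Real.sin θ) ^ 2 ≤ π ^ 2 := by nlinarith [hy.1, hy.2]
        have hr25 : r ^ 2 < 25 := by nlinarith [hr2, hc2, hs2, hπ, Real.pi_pos]
        by_contra h
        push Not at h
        nlinarith [h, hr25]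
      rw [Set.indicator_of_mem (by rw [hq]; exact ⟨⟨hx, hy⟩, hε⟩), Set.indicator_of_mem hmemA, Pi.one_apply, Pi.one_apply,
        smul_eq_mul, mul_one, mul_one]
      exact ENNReal.ofReal_le_ofReal hr5
    · rw [Set.indicator_of_notMem hS, smul_zero]
      exact bot_le
  -- (4) the area of the comparison region
  have hswap : MeasurePreserving (Prod.swap : ℝ × ℝ → ℝ × ℝ) volume volume := measurePreserving_swap
  have hA_vol : volume A = volume R := hswap.measure_preimage hRm.nullMeasurableSet
  have hR_vol : volume R = ∫⁻ θ in Ioo (-π) π, ENNReal.ofReal ((uU - uL) θ) := by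
    rw [show (volume : Measure (ℝ × ℝ)) = (volume : Measure ℝ).prod volume from rfl]
    exact volume_regionBetween_eq_lintegral' huLc.measurable huUc.measurable measurableSet_Ioo
  have hincr : ∀ θ ∈ Ioo (-π) π, ENNReal.ofReal ((uU - uL) θ) ≤ ENNReal.ofReal (2 * t / v) := fun θ hθ =>
    ENNReal.ofReal_le_ofReal (kltp_radius_increment_le htp h₁ h₂ ht htt hv hfloor (Ioo_subset_Icc_self hθ))
  calc ∫⁻ p in polarCoord.target, ENNReal.ofReal p.1 • S'.indicator (1 : ℝ × ℝ → ℝ≥0∞) (polarCoord.symm p)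
      ≤ ∫⁻ p in polarCoord.target, ENNReal.ofReal 5 * A.indicator (1 : ℝ × ℝ → ℝ≥0∞) p :=
        setLIntegral_mono' polarCoord.open_target.measurableSet hpt
    _ ≤ ∫⁻ p, ENNReal.ofReal 5 * A.indicator (1 : ℝ × ℝ → ℝ≥0∞) p := setLIntegral_le_lintegral _ _
    _ = ENNReal.ofReal 5 * volume A := by
        rw [lintegral_const_mul' _ _ ENNReal.ofReal_ne_top, lintegral_indicator_one hAm]
    _ = ENNReal.ofReal 5 * ∫⁻ θ in Ioo (-π) π, ENNReal.ofReal ((uU - uL) θ) := by rw [hA_vol, hR_vol]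
    _ ≤ ENNReal.ofReal 5 * ∫⁻ _θ in Ioo (-π) π, ENNReal.ofReal (2 * t / v) :=
        mul_le_mul' le_rfl (setLIntegral_mono' measurableSet_Ioo hincr)
    _ = ENNReal.ofReal (20 * π / v * t) := by
        rw [setLIntegral_const, Real.volume_Ioo, ← ENNReal.ofReal_mul (by positivity),
          ← ENNReal.ofReal_mul (by norm_num)]
        congr 1
        have hv0 : v ≠ 0 := hv.ne'
        field_simp
        ring

/-! ### §5 (SV) on the whole open Γ-window -/

/-- **(SV) — THE SHELL VOLUME ESTIMATE ON THE OPEN Γ-WINDOW**: for `|t′| < 1/2` and `−4 − 4t′ < μ < 4t′` there is `C ≥ 0` with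
`vol(BZ ∩ {|ε_{t′} − μ| < t}) ≤ C·t` for every `t > 0` — the `hSV` input of ✓ `klg_memLp_kernel_of_geometry`, for every Γ-window cell.
[cite: SteinHarmonicAnalysis1993, Ch. VIII §1] -/
theorem kltp_exists_shellVolume_le {tp μ : ℝ} (htp : |tp| < 1 / 2) (hμ₁ : -4 - 4 * tp < μ) (hμ₂ : μ < 4 * tp) :
    ∃ C : ℝ, 0 ≤ C ∧ ∀ t : ℝ, 0 < t →
      volume (brillouinZone ∩ {p : Momentum | |squareDispersion 1 tp p - μ| < t}) ≤ ENNReal.ofReal (C * t) := by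
  set t₀ : ℝ := min ((μ - (-4 - 4 * tp)) / 2) ((4 * tp - μ) / 2) with ht₀def
  have ht₀ : 0 < t₀ := lt_min (by linarith) (by linarith)
  have h₁ : -4 - 4 * tp < μ - t₀ := by
    have : t₀ ≤ (μ - (-4 - 4 * tp)) / 2 := min_le_left _ _
    linarith
  have h₂ : μ + t₀ < 4 * tp := by
    have : t₀ ≤ (4 * tp - μ) / 2 := min_le_right _ _
    linarith
  obtain ⟨v, hv, hfloor⟩ := kltp_exists_rayDt_floor htp h₁ h₂ ht₀.le
  refine ⟨max (20 * π / v) (4 * π ^ 2 / t₀), le_max_of_le_left (by positivity), fun t ht => ?_⟩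
  rcases le_or_gt t t₀ with hsmall | hlarge
  · exact (kltp_shellVolume_le_of_floor htp h₁ h₂ ht hsmall hv hfloor).trans
      (ENNReal.ofReal_le_ofReal (mul_le_mul_of_nonneg_right (le_max_left _ _) ht.le))
  · calc volume (brillouinZone ∩ {p : Momentum | |squareDispersion 1 tp p - μ| < t})
        ≤ volume brillouinZone := measure_mono inter_subset_left
      _ ≤ ENNReal.ofReal (4 * π ^ 2) := volume_brillouinZone_le
      _ ≤ ENNReal.ofReal (max (20 * π / v) (4 * π ^ 2 / t₀) * t) := by
          refine ENNReal.ofReal_le_ofReal ?_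
          calc 4 * π ^ 2 = 4 * π ^ 2 / t₀ * t₀ := by rw [div_mul_cancel₀ _ ht₀.ne']
            _ ≤ 4 * π ^ 2 / t₀ * t := by gcongr
            _ ≤ max (20 * π / v) (4 * π ^ 2 / t₀) * t := by gcongr; exact le_max_right _ _

end Summit.HubbardSuperconductivity.HubbardSuperconductivity.Theorems

end
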